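import Summits.AtomisticToContinuum.Crystallization.Theorems.OverbindingBudgetEnergyStraighteningHeights

/-!
# OverbindingBudget · decomp-a2c lens-4 g34 — part XXII-H: the SQUARE branch is extinguished by energy at the sharp level

Helper file under `--supports stmt-AtomisticToContinuum-31280` (RDEF = `Theses.OverbindingBudget.RobustDefectLimitWindows`); closes nothing.

Extremal reduction proper (lens-4): at the cut-of-record level `e⋆ + κ′` (part XXII-E; `e⋆ ≤ e(Q_hcp) ≤ u` certified), the square-layer alternative
of the minimal strained cell dies by ENERGY COMPARISON ALONE.  Census TAG 183 (E183.md, j344243): the straightened lower bound of EVERY near-square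
stacked cell is `≥ e_fcc − Δ_poly(S) ≈ −0.717524`, i.e. `≈ 6.5·10⁻⁵` ABOVE the certified hcp level `u ≈ −0.7175885`, so for `2κ′ < 6.5·10⁻⁵`
(of record `κ′ = 1/40000`, relative slack `≈ 22 %`) the piece NUM-S holds with the EMPTY box `[t₁, t₂] = [1, 0]`: no admissible square cell survives,
and the three square registry leaves of the cone of record (`SqRegistryGeometryW`, `SqBalancedHeight`, `SqRegistryMetric[CW]`, all conditioned on
`PinnedSq t₁ t₂ a b`) become VACUOUS and are PROVED here.
* SQX `SquareCellsExtinct Λ₁ η₁ η₂ e` [CERT·M, configuration-free]: every near-square in-plane cell (`IsSType`, lattice vectors `≥ 9/10`, `‖a‖, ‖b‖ ≤ Λ₁`),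
  every unit normal, every height `h̄ ∈ [η₁, η₂]`: `e ≤ φ₀(a,b)/2 + Σ_s layerField a b (v s)` for all inter-layer offsets — NUM-S without a box.
  Why it might fail: only numerically — the float margin `6.5·10⁻⁵ − 2κ′` must survive interval certification over the whole S-region (minimum at the
  symmetric fcc{100} point; rhombic / rectangular distortions and off-optimal heights cost elastic energy).
Seams PROVED: `straightCellEnergyS_of_extinct`, the vacuous square leaves `sqRegistryGeometryW_empty`, `sqBalancedHeight_empty`, `sqRegistryMetric_empty`,
`sqRegistryMetricCW_empty`; cones XXIX `rdef_twentyninth_of_recordK_sqExtinct[_ref] (s₁ s₂ h₀ κ′)`: beneath ★ the open energy leaves are STR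
`StraightenedFloor (17/16)`, NUM-T `StraightCellEnergyT (17/16) (3/8) (23/20) s₁ s₂ (e⋆ + 2κ′)` and SQX `SquareCellsExtinct (17/16) (3/8) (23/20) (e⋆ + 2κ′)`;
the square registry leaves and the literals `t₁ t₂ h₁` are GONE from the cone.
-/

noncomputable section

namespace Summit.AtomisticToContinuum.Crystallization.Theorems.OverbindingBudgetEnergySquareExtinction

open Metric
open scoped RealInnerProductSpace
open Literature.MathematicalPhysics.StatisticalMechanics (lennardJones groundStateEnergy)
open Summit.AtomisticToContinuum.Crystallization.Theses.OverbindingBudget (RobustDefectLimitWindows)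
open Summit.AtomisticToContinuum.Crystallization.Theses.PricedLinkCensus (ChargedEnergyGap)
open Summit.AtomisticToContinuum.Crystallization.Theorems.ChargedEnergyGapNegative (eStar)
open Summit.AtomisticToContinuum.Crystallization.Theorems.OverbindingBudgetGradedBareness (CleanlessExcessT)
open Summit.AtomisticToContinuum.Crystallization.Theorems.OverbindingBudgetCoherentCut (CoherentResidual)
open Summit.AtomisticToContinuum.Crystallization.Theorems.OverbindingBudgetUniformCutStatements (GrossCleanBallsU)
open Summit.AtomisticToContinuum.Crystallization.Theorems.OverbindingBudgetElasticSplitScale (CompressedVirialLaw)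
open Summit.AtomisticToContinuum.Crystallization.Theorems.OverbindingBudgetElasticSplitShear (StressFree)
open Summit.AtomisticToContinuum.Crystallization.Theorems.ChartedPlanarOrderChunkFloor (E3)
open Summit.AtomisticToContinuum.Crystallization.Theorems.ChartedPlanarOrderRigidityDoor (IsNash)
open Summit.AtomisticToContinuum.Crystallization.Theorems.ChartedPlanarOrderDensityDichotomy (μS IsSep)
open Summit.AtomisticToContinuum.Crystallization.Theorems.ChartedPlanarOrderDoorLayered (Layered)
open Summit.AtomisticToContinuum.Crystallization.Theorems.ChartedPlanarOrderProfileSlavingLJ (IsStacked gapStress incr)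
open Summit.AtomisticToContinuum.Crystallization.Theorems.ChartedPlanarOrderTubeConvex (TubeConvexW' TubeConvexRef)
open Summit.AtomisticToContinuum.Crystallization.Theorems.OverbindingBudgetScaleWidening (IsCleanW DoorPeriodicW)
open Summit.AtomisticToContinuum.Crystallization.Theorems.OverbindingBudgetTwoShellShape (TwoShellShape BarlowGluingW)
open Summit.AtomisticToContinuum.Crystallization.Theorems.OverbindingBudgetStackedRigidityW (StackedReductionW GapStressVanishesW)
open Summit.AtomisticToContinuum.Crystallization.Theorems.OverbindingBudgetStackedRigidityRef (RegistryPinningW)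
open Summit.AtomisticToContinuum.Crystallization.Theorems.OverbindingBudgetRegistryCut (IsUnitNormal Pinned RegistryResidual RegistryTube RegistryMetric)
open Summit.AtomisticToContinuum.Crystallization.Theorems.OverbindingBudgetRegistrySquare (PinnedSq)
open Summit.AtomisticToContinuum.Crystallization.Theorems.OverbindingBudgetRegistryDichotomy (IsTType IsSType RegistryGeometryW BalancedLocus
  SqRegistryGeometryW SqBalancedHeight SqRegistryMetric)
open Summit.AtomisticToContinuum.Crystallization.Theorems.OverbindingBudgetRegistryDichotomyCW (RegistryMetricCW SqRegistryMetricCW)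
open Summit.AtomisticToContinuum.Crystallization.Theorems.OverbindingBudgetEnergyPinning (StackedCellPinningU)
open Summit.AtomisticToContinuum.Crystallization.Theorems.OverbindingBudgetEnergyStraightening (StraightBound StraightenedFloor StraightCellEnergyT
  StraightCellEnergyS)
open Summit.AtomisticToContinuum.Crystallization.Theorems.OverbindingBudgetEnergyStraighteningHeights (stackedCellPinningU_of_straight_band
  rdef_twentyeighth_of_recordK_straight rdef_twentyeighth_of_recordK_straight_ref)

/-! ## §1 The piece: square cells are extinct at level `e` -/

/-- **SQX · `SquareCellsExtinct Λ₁ η₁ η₂ e`** [CERT·M, configuration-free]: for EVERY near-square in-plane cell `(a, b)` (`IsSType`, lattice vectors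
`≥ 9/10`, `‖a‖, ‖b‖ ≤ Λ₁`), every unit normal `n` and every height `h̄ ∈ [η₁, η₂]`, the level `e` lies below the straightened half site energy for
all inter-layer offsets (`StraightBound a b n h̄ e`).  Why it might fail: the census float margin `e_LB(S) − u ≈ 6.5·10⁻⁵` (TAG 183) must exceed `2κ′`
after interval certification over the whole S-region and height band. [piece] -/
def SquareCellsExtinct (Λ₁ η₁ η₂ e : ℝ) : Prop :=
  ∀ (a b n : E3), LinearIndependent ℝ ![a, b] → ‖a‖ ≤ Λ₁ → ‖b‖ ≤ Λ₁ →
    (∀ i j : ℤ, ((i : ℝ) • a + (j : ℝ) • b) ≠ 0 → 9 / 10 ≤ ‖(i : ℝ) • a + (j : ℝ) • b‖) → IsUnitNormal a b n → IsSType a b →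
    ∀ h : ℝ, η₁ ≤ h → h ≤ η₂ → StraightBound a b n h e

/-- SQX is NUM-S for every box (the box hypothesis is simply not used). [this file] -/
theorem straightCellEnergyS_of_extinct {Λ₁ η₁ η₂ e : ℝ} (h : SquareCellsExtinct Λ₁ η₁ η₂ e) (t₁ t₂ : ℝ) :
    StraightCellEnergyS Λ₁ η₁ η₂ t₁ t₂ e :=
  fun a b n hab ha hb hlat hn hS _ hh h₁ h₂ => h a b n hab ha hb hlat hn hS hh h₁ h₂

/-! ## §2 The empty square box `[1, 0]`: the square registry leaves are vacuous (PROVED) -/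

/-- No cell is pinned in the empty box `[1, 0]`. [bookkeeping] -/
theorem not_pinnedSq_one_zero (a b : E3) : ¬ PinnedSq 1 0 a b := by
  rintro ⟨h1, h2, -⟩
  linarith

/-- `SqRegistryGeometryW Λ₁ 1 0 h₁ τ₀` holds vacuously. [this file] -/
theorem sqRegistryGeometryW_empty (Λ₁ h₁ τ₀ : ℝ) : SqRegistryGeometryW Λ₁ 1 0 h₁ τ₀ :=
  fun _ _ a b _ _ _ _ _ _ _ _ _ _ hp => (not_pinnedSq_one_zero a b hp).elim

/-- `SqBalancedHeight 1 0 h₁ τ` holds vacuously. [this file] -/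
theorem sqBalancedHeight_empty (h₁ τ : ℝ) : SqBalancedHeight 1 0 h₁ τ :=
  fun a b _ hp _ => (not_pinnedSq_one_zero a b hp).elim

/-- `SqRegistryMetric 1 0 h₁ τ r″` holds vacuously. [this file] -/
theorem sqRegistryMetric_empty (h₁ τ r'' : ℝ) : SqRegistryMetric 1 0 h₁ τ r'' :=
  fun a b _ _ _ _ hp => (not_pinnedSq_one_zero a b hp).elim

/-- `SqRegistryMetricCW 1 0 h₁ τ r″` holds vacuously. [this file] -/
theorem sqRegistryMetricCW_empty (h₁ τ r'' : ℝ) : SqRegistryMetricCW 1 0 h₁ τ r'' :=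
  fun a b _ _ _ _ hp => (not_pinnedSq_one_zero a b hp).elim

/-! ## §3 Seam and cones XXIX: the square branch leaves the cone -/

/-- ★ the energy cut with the square branch extinguished: STR ∧ NUM-T(e⋆ + 2κ′) ∧ SQX(e⋆ + 2κ′) ⇒ ★ `StackedCellPinningU Λ₁ s₁ s₂ 1 0` (empty square box;
`0 < κ′`, `Λ₁ ≤ 17/16`). [this file] -/
theorem stackedCellPinningU_of_sqExtinct {Λ₁ s₁ s₂ κ' : ℝ} (hκ' : 0 < κ') (hΛ₁ : Λ₁ ≤ 17 / 16) (hSTR : StraightenedFloor Λ₁)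
    (hT : StraightCellEnergyT Λ₁ (3 / 8) (23 / 20) s₁ s₂ (eStar + 2 * κ')) (hX : SquareCellsExtinct Λ₁ (3 / 8) (23 / 20) (eStar + 2 * κ')) :
    StackedCellPinningU Λ₁ s₁ s₂ 1 0 :=
  stackedCellPinningU_of_straight_band hκ' hΛ₁ hSTR hT (straightCellEnergyS_of_extinct hX 1 0)

/-- ★ **RDEF cone, TWENTY-NINTH form at the numbers of record: ENERGY PINNING, SQUARE BRANCH EXTINGUISHED** (W′ currency): beneath 7d the open energy
leaves are STR `StraightenedFloor (17/16)` [ANALYTIC·M], NUM-T `StraightCellEnergyT (17/16) (3/8) (23/20) s₁ s₂ (e⋆ + 2κ′)` and SQX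
`SquareCellsExtinct (17/16) (3/8) (23/20) (e⋆ + 2κ′)` [CERT·M]; the square registry leaves and the literals `t₁ t₂ h₁` are gone; T-box `[s₁, s₂]`, `h₀`, `κ′`
SYMBOLIC (of record `κ′ ≤ 1/40000` by TAG 183). [this file] -/
theorem rdef_twentyninth_of_recordK_sqExtinct (s₁ s₂ h₀ κ' : ℝ) (hκ' : 0 < κ') (hG : GrossCleanBallsU (1 / 250) 10) (hCEG : ChargedEnergyGap)
    (hC : CompressedVirialLaw (1 / 250) 10) (hS : TwoShellShape (1 / 100) (3 / 50) (1 / 450)) (hB₂ : BarlowGluingW) (hD : DoorPeriodicW 2)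
    (hSR : StackedReductionW 2 (17 / 16)) (hV : GapStressVanishesW (17 / 16)) (hP : RegistryPinningW (17 / 16) (1 / 40) (3 / 16))
    (hT : TubeConvexW' (17 / 16) (1 / 40)) (hSTR : StraightenedFloor (17 / 16))
    (hNT : StraightCellEnergyT (17 / 16) (3 / 8) (23 / 20) s₁ s₂ (eStar + 2 * κ')) (hX : SquareCellsExtinct (17 / 16) (3 / 8) (23 / 20) (eStar + 2 * κ'))
    (hGeo : RegistryGeometryW (17 / 16) s₁ s₂ h₀ (3 / 20)) (hBal : BalancedLocus s₁ s₂ h₀ (1 / 40)) (hR1 : RegistryResidual s₁ s₂ (1 / 250))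
    (hR2 : RegistryTube s₁ s₂ (1 / 100) 1) (hMet : RegistryMetric s₁ s₂ (3 / 500)) (hCE : CleanlessExcessT) (hRes : CoherentResidual 10) :
    RobustDefectLimitWindows :=
  rdef_twentyeighth_of_recordK_straight s₁ s₂ 1 0 h₀ 0 κ' hκ' hG hCEG hC hS hB₂ hD hSR hV hP hT hSTR hNT (straightCellEnergyS_of_extinct hX 1 0) hGeo
    hBal hR1 hR2 hMet (sqRegistryGeometryW_empty _ _ _) (sqBalancedHeight_empty _ _) (sqRegistryMetric_empty _ _ _) hCE hRes

/-- ★ **RDEF cone, twenty-ninth form at the numbers of record, reference-centred (CURRENCY OF RECORD): ENERGY PINNING, SQUARE BRANCH EXTINGUISHED.**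
[this file] -/
theorem rdef_twentyninth_of_recordK_sqExtinct_ref (s₁ s₂ h₀ κ' : ℝ) (hκ' : 0 < κ') (hG : GrossCleanBallsU (1 / 250) 10) (hCEG : ChargedEnergyGap)
    (hC : CompressedVirialLaw (1 / 250) 10) (hS : TwoShellShape (1 / 100) (3 / 50) (1 / 450)) (hB₂ : BarlowGluingW) (hD : DoorPeriodicW 2)
    (hSR : StackedReductionW 2 (17 / 16)) (hV : GapStressVanishesW (17 / 16)) (hP : RegistryPinningW (17 / 16) (1 / 40) (3 / 16))
    (hT : TubeConvexRef (17 / 16) (1 / 40)) (hSTR : StraightenedFloor (17 / 16))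
    (hNT : StraightCellEnergyT (17 / 16) (3 / 8) (23 / 20) s₁ s₂ (eStar + 2 * κ')) (hX : SquareCellsExtinct (17 / 16) (3 / 8) (23 / 20) (eStar + 2 * κ'))
    (hGeo : RegistryGeometryW (17 / 16) s₁ s₂ h₀ (3 / 20)) (hBal : BalancedLocus s₁ s₂ h₀ (1 / 40)) (hR1 : RegistryResidual s₁ s₂ (1 / 250))
    (hR2 : RegistryTube s₁ s₂ (1 / 100) 1) (hMet : RegistryMetricCW s₁ s₂ (3 / 500)) (hCE : CleanlessExcessT) (hRes : CoherentResidual 10) :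
    RobustDefectLimitWindows :=
  rdef_twentyeighth_of_recordK_straight_ref s₁ s₂ 1 0 h₀ 0 κ' hκ' hG hCEG hC hS hB₂ hD hSR hV hP hT hSTR hNT (straightCellEnergyS_of_extinct hX 1 0)
    hGeo hBal hR1 hR2 hMet (sqRegistryGeometryW_empty _ _ _) (sqBalancedHeight_empty _ _) (sqRegistryMetricCW_empty _ _ _) hCE hRes

end Summit.AtomisticToContinuum.Crystallization.Theorems.OverbindingBudgetEnergySquareExtinction

end
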